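/-
Copyright: statement-level skeleton of a published paper (lit-balaban cell, Phase-2 proof seat p25, gen 19). No proof
claims beyond what the kernel checks below.
-/
import Literature.MathematicalPhysics.QuantumFieldTheory.BalabanImbrieJaffe1984to88.BIJ88WalkLocalTermCount312
import Literature.MathematicalPhysics.QuantumFieldTheory.BalabanImbrieJaffe1984to88.BIJ88WalkRemainderRecords312

/-!
# `BalabanImbrieJaffe1984to88.BIJ88WalkRemainderShape312` — T. Bałaban, J. Imbrie, A. Jaffe, *Effective action and
cluster properties of the abelian Higgs model*, Commun. Math. Phys. **114** (1988) 257–315 [BalabanImbrieJaffe1988],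
§5.14 p. 311–312 [PDF 55–56], verbatim: *"The components containing contractions to χ′_{Λ^{(k)}}, terms from the random
walk expansions, or at least m̄+1 interactions are called remainder components {X_r}."* (p. 311), *"By performing
sufficiently many integrations by parts, we have arranged for enough small factors to beat these large factors in the
remainder terms (at least if X_{r′} is not at the boundary of Λ^{(k)})."* (p. 312), and p. 310 [PDF 54] on the
random-walk terms: *"The others, localized in region X, have a factor of e^{−cr(e_k)|X|}."* — **THE PRINTED CURRENCY
REFINED BY ONE SMALL FACTOR PER VERTEX AND ONE PER RANDOM-WALK TERM** (p25 gen 19): gen 18's currency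
(`BIJ88WalkActivityShape312.shape`: a large constant `B_ℓ^{|obs j|}` per observable, a small `θ` per uncovered cube)
spends the vertex couplings and the walk factors entirely on the cubes; here a vertex is allowed to keep an extra
factor `θ_v` (*coupling constant*) and a random-walk piece an extra factor `θ_w` besides the `θ` per cube of its
region: `wt X ≤ shape X · θ_v^{#vxs X} · θ_w^{#walk pieces of X}` (`wt_le_rshape`).  With the records of
`BIJ88WalkRemainderRecords312` a REMAINDER component without `χ′`-contraction therefore carries at least the extra
small factor `max(θ_v^M, θ_w)` (`sf_le_of_isRem`) — two of print's three sources of smallness of `X_r`; the third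
(a `χ′`-contraction) is analytic and enters through the directions in the sequel.  The ℓ¹ norm of the whole expansion
in the refined currency is again volume-uniform (`expand_l1_rshape_le`).

statement-level skeleton of published theorems with citation tags; proofs where landed; nothing here is a claim
about the Yang–Mills mass gap

PDF held: `paper:balaban1988-cmp114-bij-abelian-higgs-effective-action` (journal page = PDF page + 256); p. 310–312 =
PDF 54–56 (`p0054.txt` L28–31, `p0055.txt` L29–38, `p0056.txt` L20–25 re-read this session, 2026-08-23).

CITATION HEADER (lean-in-tree rule).  lit-balaban cell (HOME `run/shared/lean/pub/lit-balaban/`), Phase 2, seat p25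
gen 19; row **C2.Claim@312** of `HOME/lit-balaban-r16/ROWS-C2-part2.md` (owner r16, referee ref-5; head
`BIJ88Sect5StatementsPart4.Ineq312` untouched — MEMBER of the row).  USED BY NAME, nothing restated:
`BIJ88WalkActivityShape312.{shape, card_cubes_sdiff_le, expand_tidy, envOK_zero}`, `BIJ88WalkWeights312.{wt, Tidy,
budget, card_pcs_le_budget, expand_weight_init}`, `BIJ88WalkLocalTermCount312.expand_lsum_init_le`,
`BIJ88WalkTermCount312.pw`, `BIJ88WalkExpansionGeo311.NondegT`, `BIJ88WalkGeometry311.cubes`, `BIJ88WalkRun311`,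
`BIJ88WalkExpansion311` (p25 gen 18), `BIJ88WalkRemainderRecords312` (p25 gen 19), `BIJ88VertexComponents311.maxArity`.

## What is proved (0 `sorry`, standard axioms, no new `Prop` facts; definitions with bodies: `sf`, `rshape`)

* §1 `sf` (the record small factors `θ_v^{#vxs}·θ_w^{#walk pieces}`), `rshape = shape · sf`, `sf_nonneg`, `sf_le_one`,
  **`sf_le_of_isRem`** (a remainder component with no `χ′`-contraction has `sf ≤ max(θ_v^M, θ_w)`).
* §2 **`wt_le_rshape`** (the weight of a tidy component in the refined currency).
* §3 **`expand_rshape_init`** (every term: `|coef_t|·Π‖dirs_t‖ ≤ Π_{X ∈ t.consts + t.groups} rshape X`),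
  **`expand_l1_rshape_le`** (`Σ_{t ∈ expand 0 K} |coef_t|·Π‖dirs_t‖ / Π_X rshape X ≤ W^{Φ₀(K)}`).
HONEST SCOPE: (a) `θ_v`, `θ_w` are free data in the hypotheses `cV m·B_ℓ^{|legs m|} ≤ θ_v·θ^{#vc m}` and
`B′_p ≤ θ_w·θ^{#reg p}` (walk pieces) — print's coupling constants and `e^{−cr(e_k)}` are not quantified here;
(b) locality (`ρ₀`, `N₀`) abstract as in gen 18; (c) the `χ′` small factor is NOT in this file; (d) contraction-graph
components; (e) no `Ineq312` binder.  NOT summit progress; NOT continuum; NOT Clay.  Imports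
`BIJ88WalkLocalTermCount312`, `BIJ88WalkRemainderRecords312`; modifies nothing.
-/

noncomputable section

namespace Literature.MathematicalPhysics.QuantumFieldTheory.BalabanImbrieJaffe1984to88.BIJ88WalkRemainderShape312

open Classical Matrix Finset
open scoped BigOperators
open BIJ88VertexComponents311 (maxArity)
open BIJ88WalkRun311 BIJ88WalkRunEnv311 BIJ88WalkGeometry311 BIJ88WalkExpansion311 BIJ88WalkExpansionGeo311
  BIJ88WalkWeights312 BIJ88WalkActivityShape312 BIJ88WalkTermCount312 BIJ88WalkLocalTermCount312
  BIJ88WalkRemainderRecords312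

variable {S : Type} [Fintype S] {ι : Type} [Fintype ι] {κ : Type} [LinearOrder κ] {P : Type} [Fintype P]
  {β : Type} [DecidableEq β]

/-! ## §1  The record small factors -/

section Defs

variable (trig : P → Bool) (θv θw : ℝ)

/-- **The small factors a component's records are worth**: `θ_v` per vertex differentiated down, `θ_w` per
random-walk piece used (p. 311: the remainder components are those with a `χ′`-contraction, at least `m̄+1` vertices,
or a random-walk term). [cite: BalabanImbrieJaffe1988, §5.14 p.311–312] -/
def sf (g : WGrp S κ ι P) : ℝ := θv ^ Multiset.card g.vxs * θw ^ g.pcs.countP (fun q => trig q = true)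

/-- **The refined currency of a component**: gen 18's printed shape `(Π_{j∈X.lab} B_ℓ^{|obs j|})·θ^{#(cubes X ∖ obs cubes)}`
times the record small factors. [cite: BalabanImbrieJaffe1988, §5.14 p.312] -/
def rshape (obs : κ → List (S → ℝ)) (oc : κ → Finset β) (vc : ι → Finset β) (reg : P → Finset β) (Bl θ : ℝ)
    (g : WGrp S κ ι P) : ℝ :=
  shape obs oc vc reg Bl θ g * sf trig θv θw g

variable {trig θv θw}

omit [Fintype S] [Fintype ι] [LinearOrder κ] [Fintype P] in
/-- `0 ≤ sf` for `θ_v, θ_w ≥ 0` (bookkeeping). [cite: BalabanImbrieJaffe1988, §5.14 p.312] -/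
theorem sf_nonneg (hθv : 0 ≤ θv) (hθw : 0 ≤ θw) (g : WGrp S κ ι P) : 0 ≤ sf trig θv θw g :=
  mul_nonneg (pow_nonneg hθv _) (pow_nonneg hθw _)

omit [Fintype S] [Fintype ι] [LinearOrder κ] [Fintype P] in
/-- `sf ≤ 1` for `θ_v, θ_w ∈ [0, 1]` (bookkeeping). [cite: BalabanImbrieJaffe1988, §5.14 p.312] -/
theorem sf_le_one (hθv : 0 ≤ θv) (hθv1 : θv ≤ 1) (hθw : 0 ≤ θw) (hθw1 : θw ≤ 1) (g : WGrp S κ ι P) :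
    sf trig θv θw g ≤ 1 :=
  mul_le_one₀ (pow_le_one₀ hθv hθv1) (pow_nonneg hθw _) (pow_le_one₀ hθw hθw1)

omit [Fintype S] [Fintype ι] [LinearOrder κ] [Fintype P] in
/-- **A REMAINDER COMPONENT WITHOUT `χ′`-CONTRACTION CARRIES AN EXTRA SMALL FACTOR** (p. 311: *"… terms from the
random walk expansions, or at least m̄+1 interactions …"*): if `X.IsRem M`, `X.nchi = 0` and the random-walk count is
the number of triggering pieces recorded, then `sf X ≤ max(θ_v^M, θ_w)`. [cite: BalabanImbrieJaffe1988, §5.14 p.311–312] -/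
theorem sf_le_of_isRem (hθv : 0 ≤ θv) (hθv1 : θv ≤ 1) (hθw : 0 ≤ θw) (hθw1 : θw ≤ 1) {M : ℕ} {g : WGrp S κ ι P}
    (hrem : g.IsRem M) (hchi : g.nchi = 0) (hnw : g.nw = g.pcs.countP (fun q => trig q = true)) :
    sf trig θv θw g ≤ max (θv ^ M) θw := by
  rcases hrem with h | h | h
  · omega
  · -- at least `M` vertices
    calc sf trig θv θw g ≤ θv ^ Multiset.card g.vxs * 1 :=
          mul_le_mul_of_nonneg_left (pow_le_one₀ hθw hθw1) (pow_nonneg hθv _)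
      _ ≤ θv ^ M := by rw [mul_one]; exact pow_le_pow_of_le_one hθv hθv1 h
      _ ≤ _ := le_max_left _ _
  · -- a random-walk piece
    rw [hnw] at h
    calc sf trig θv θw g ≤ 1 * θw ^ g.pcs.countP (fun q => trig q = true) :=
          mul_le_mul_of_nonneg_right (pow_le_one₀ hθv hθv1) (pow_nonneg hθw _)
      _ ≤ θw ^ 1 := by rw [one_mul]; exact pow_le_pow_of_le_one hθw hθw1 h
      _ ≤ _ := by rw [pow_one]; exact le_max_right _ _

end Defs

/-! ## §2  The weight of a tidy component in the refined currency -/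

omit [LinearOrder κ] [DecidableEq β] in
/-- `Π_{a ∈ m} θ^{n a} = θ^{Σ_{a ∈ m} n a}` (bookkeeping). [folklore] -/
private theorem prod_map_pow_eq {α : Type} (m : Multiset α) (θ : ℝ) (n : α → ℕ) :
    (m.map fun a => θ ^ n a).prod = θ ^ (m.map n).sum := by
  induction m using Multiset.induction_on with
  | empty => simp
  | cons a m ih => simp only [Multiset.map_cons, Multiset.prod_cons, Multiset.sum_cons, ih, pow_add]

omit [LinearOrder κ] [DecidableEq β] in
/-- `Π_{a ∈ m} f a ≤ B^{#m}` when `0 ≤ f ≤ B` on `m` (bookkeeping). [folklore] -/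
private theorem prod_map_le_pow_card {α : Type} (m : Multiset α) {f : α → ℝ} {B : ℝ} (h0 : ∀ a ∈ m, 0 ≤ f a)
    (h : ∀ a ∈ m, f a ≤ B) : (m.map f).prod ≤ B ^ Multiset.card m := by
  have h1 := Multiset.prod_map_le_prod_map₀ f (fun _ => B) h0 h
  rwa [Multiset.map_const', Multiset.prod_replicate] at h1

omit [LinearOrder κ] [DecidableEq β] in
/-- `Π_{a ∈ m} (c · θ^{n a}) = c^{#m} · θ^{Σ n}` (bookkeeping). [folklore] -/
private theorem prod_map_const_mul_pow {α : Type} (m : Multiset α) (cst θ : ℝ) (n : α → ℕ) :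
    (m.map fun a => cst * θ ^ n a).prod = cst ^ Multiset.card m * θ ^ (m.map n).sum := by
  rw [Multiset.prod_map_mul, Multiset.map_const', Multiset.prod_replicate, prod_map_pow_eq]

omit [LinearOrder κ] [DecidableEq β] in
/-- A sum of zeros over a multiset vanishes (bookkeeping). [folklore] -/
private theorem sum_map_eq_zero {α : Type} (m : Multiset α) {n : α → ℕ} (h : ∀ a ∈ m, n a = 0) : (m.map n).sum = 0 := by
  rw [Multiset.sum_eq_zero]
  intro x hx
  obtain ⟨a, ha, rfl⟩ := Multiset.mem_map.1 hx
  exact h a ha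

omit [Fintype S] [Fintype ι] [LinearOrder κ] [Fintype P] in
/-- **THE WEIGHT OF A TIDY COMPONENT IN THE REFINED CURRENCY**: local brackets `≤ B_ℓ` (`B_ℓ ≥ 1`, no region),
random-walk brackets `≤ θ_w·θ^{#reg p}`, vertices `cV m·B_ℓ^{|legs m|} ≤ θ_v·θ^{#vc m}`, `0 < θ ≤ 1`, `θ_v, θ_w ≥ 0`;
then `wt X ≤ shape X · θ_v^{#vxs X} · θ_w^{#walk pieces of X} = rshape X`. [cite: BalabanImbrieJaffe1988, §5.14 p.312] -/
theorem wt_le_rshape {trig : P → Bool} {obs : κ → List (S → ℝ)} {legs : ι → List (S → ℝ)} {oc : κ → Finset β}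
    {vc : ι → Finset β} {reg : P → Finset β} {B : P → ℝ} {cV : ι → ℝ} {Bl θ θv θw : ℝ} (hθ0 : 0 < θ) (hθ1 : θ ≤ 1)
    (hBl : 1 ≤ Bl) (hB0 : ∀ p, 0 ≤ B p) (hcV0 : ∀ m, 0 ≤ cV m) (hθv : 0 ≤ θv) (hθw : 0 ≤ θw)
    (hloc : ∀ p, trig p = false → B p ≤ Bl ∧ reg p = ∅) (hwalk : ∀ p, trig p = true → B p ≤ θw * θ ^ (reg p).card)
    (hvert : ∀ m, cV m * Bl ^ (legs m).length ≤ θv * θ ^ (vc m).card) (g : WGrp S κ ι P) (hg : Tidy obs legs g) :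
    wt B cV g ≤ rshape trig θv θw obs oc vc reg Bl θ g := by
  have hBl0 : 0 ≤ Bl := zero_le_one.trans hBl
  -- split the pieces into random-walk and local ones
  set Wk := g.pcs.filter fun p => trig p = true with hWk
  set Lc := g.pcs.filter fun p => ¬ trig p = true with hLc
  have hsplit : g.pcs = Wk + Lc := (Multiset.filter_add_not _ g.pcs).symm
  have hWkm : ∀ p ∈ Wk, trig p = true := fun p hp => (Multiset.mem_filter.1 hp).2
  have hLcm : ∀ p ∈ Lc, trig p = false := fun p hp => by
    have h := (Multiset.mem_filter.1 hp).2
    cases htr : trig p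
    · rfl
    · exact absurd htr h
  have hcount : g.pcs.countP (fun q => trig q = true) = Multiset.card Wk := by
    rw [hWk, Multiset.countP_eq_card_filter]
  -- (i) local brackets: at most `Bl^{#pcs} ≤ Bl^{budget}`
  have hPL : (Lc.map B).prod ≤ Bl ^ budget obs legs g := by
    refine (prod_map_le_pow_card Lc (fun p _ => hB0 p) fun p hp => (hloc p (hLcm p hp)).1).trans ?_
    exact pow_le_pow_right₀ hBl ((Multiset.card_le_card (Multiset.filter_le _ _)).trans (card_pcs_le_budget hg))
  -- (ii) random-walk brackets: `θ_w` per piece and `θ` per cube of the regions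
  have hPW : (Wk.map B).prod ≤ θw ^ Multiset.card Wk * θ ^ (g.pcs.map fun p => (reg p).card).sum := by
    have h1 : (Wk.map B).prod ≤ (Wk.map fun p => θw * θ ^ (reg p).card).prod :=
      Multiset.prod_map_le_prod_map₀ _ _ (fun p _ => hB0 p) fun p hp => hwalk p (hWkm p hp)
    rw [prod_map_const_mul_pow] at h1
    have h2 : (g.pcs.map fun p => (reg p).card).sum = (Wk.map fun p => (reg p).card).sum := by
      rw [hsplit, Multiset.map_add, Multiset.sum_add, sum_map_eq_zero Lc fun p hp => by
        rw [(hloc p (hLcm p hp)).2, Finset.card_empty], add_zero]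
    rwa [h2]
  -- (iii) vertices: after paying for their legs' brackets, `θ_v` per vertex and `θ` per cube of the localizations
  have hPV : (g.vxs.map cV).prod * Bl ^ (g.vxs.map fun m => (legs m).length).sum
      ≤ θv ^ Multiset.card g.vxs * θ ^ (g.vxs.map fun m => (vc m).card).sum := by
    rw [← prod_map_pow_eq g.vxs Bl, ← Multiset.prod_map_mul, ← prod_map_const_mul_pow]
    exact Multiset.prod_map_le_prod_map₀ _ _ (fun m _ => mul_nonneg (hcV0 m) (pow_nonneg hBl0 _)) fun m _ => hvert m
  -- assemble
  have hPL0 : 0 ≤ (Lc.map B).prod :=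
    Multiset.prod_nonneg fun x hx => by obtain ⟨p, -, rfl⟩ := Multiset.mem_map.1 hx; exact hB0 p
  have hPW0 : 0 ≤ (Wk.map B).prod :=
    Multiset.prod_nonneg fun x hx => by obtain ⟨p, -, rfl⟩ := Multiset.mem_map.1 hx; exact hB0 p
  have hPV0 : 0 ≤ (g.vxs.map cV).prod :=
    Multiset.prod_nonneg fun x hx => by obtain ⟨m, -, rfl⟩ := Multiset.mem_map.1 hx; exact hcV0 m
  have hexp : (cubes oc vc reg g \ g.lab.biUnion oc).card
      ≤ (g.vxs.map fun m => (vc m).card).sum + (g.pcs.map fun p => (reg p).card).sum := card_cubes_sdiff_le oc vc reg g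
  have hsf : sf trig θv θw g = θv ^ Multiset.card g.vxs * θw ^ Multiset.card Wk := by rw [sf, hcount]
  calc wt B cV g = (Lc.map B).prod * (Wk.map B).prod * (g.vxs.map cV).prod := by
        rw [wt, hsplit, Multiset.map_add, Multiset.prod_add]; ring
    _ ≤ Bl ^ budget obs legs g * (Wk.map B).prod * (g.vxs.map cV).prod :=
        mul_le_mul_of_nonneg_right (mul_le_mul_of_nonneg_right hPL hPW0) hPV0
    _ = Bl ^ (∑ j ∈ g.lab, (obs j).length) *
          (((g.vxs.map cV).prod * Bl ^ (g.vxs.map fun m => (legs m).length).sum) * (Wk.map B).prod) := by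
        rw [budget, pow_add]; ring
    _ ≤ Bl ^ (∑ j ∈ g.lab, (obs j).length) *
          ((θv ^ Multiset.card g.vxs * θ ^ (g.vxs.map fun m => (vc m).card).sum)
            * (θw ^ Multiset.card Wk * θ ^ (g.pcs.map fun p => (reg p).card).sum)) :=
        mul_le_mul_of_nonneg_left (mul_le_mul hPV hPW hPW0 (mul_nonneg (pow_nonneg hθv _) (pow_nonneg hθ0.le _)))
          (pow_nonneg hBl0 _)
    _ = Bl ^ (∑ j ∈ g.lab, (obs j).length) *
          θ ^ ((g.vxs.map fun m => (vc m).card).sum + (g.pcs.map fun p => (reg p).card).sum)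
            * (θv ^ Multiset.card g.vxs * θw ^ Multiset.card Wk) := by rw [pow_add]; ring
    _ ≤ Bl ^ (∑ j ∈ g.lab, (obs j).length) * θ ^ (cubes oc vc reg g \ g.lab.biUnion oc).card
            * (θv ^ Multiset.card g.vxs * θw ^ Multiset.card Wk) :=
        mul_le_mul_of_nonneg_right (mul_le_mul_of_nonneg_left (pow_le_pow_of_le_one hθ0.le hθ1 hexp) (pow_nonneg hBl0 _))
          (mul_nonneg (pow_nonneg hθv _) (pow_nonneg hθw _))
    _ = rshape trig θv θw obs oc vc reg Bl θ g := by
        rw [rshape, shape, hsf, Finset.prod_pow_eq_pow_sum]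

/-! ## §3  Every term in the refined currency; the ℓ¹ norm of the expansion in the refined currency -/

section Expand

variable {Cov : P → Matrix S S ℝ} {trig : P → Bool} {f : S → ℝ} {c : ι → ℝ} {legs : ι → List (S → ℝ)}
  {obs : κ → List (S → ℝ)} {M : ℕ} {oc : κ → Finset β} {vc : ι → Finset β} {reg : P → Finset β}

/-- **EVERY TERM IN THE REFINED CURRENCY, COMPONENT BY COMPONENT**: under the bracket/coupling hypotheses of
`BIJ88WalkWeights312.run_weight` and the refined currency hypotheses of `wt_le_rshape`, every term `t` of `expand 0 K`
satisfies `|coef_t|·Π_{z ∈ dirs_t}‖z‖ ≤ Π_{X ∈ t.consts + t.groups} rshape X`. [cite: BalabanImbrieJaffe1988, §5.14 p.312] -/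
theorem expand_rshape_init {Dir : Set (S → ℝ)} {B : P → ℝ} {cV : ι → ℝ} {Bl θ θv θw : ℝ} (hθ0 : 0 < θ) (hθ1 : θ ≤ 1)
    (hBl : 1 ≤ Bl) (hB0 : ∀ p, 0 ≤ B p) (hcV0 : ∀ m, 0 ≤ cV m) (hθv : 0 ≤ θv) (hθw : 0 ≤ θw)
    (hB : ∀ p, ∀ u ∈ Dir, ∀ w ∈ Dir, |(Cov p *ᵥ u) ⬝ᵥ w| ≤ B p)
    (hBf : ∀ p, ∀ u ∈ Dir, |(Cov p *ᵥ u) ⬝ᵥ f| ≤ B p) (hBz : ∀ p, ∀ u ∈ Dir, ‖Cov p *ᵥ u‖ ≤ B p)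
    (hcV : ∀ m, |c m| ≤ cV m) (hobs : ∀ j, ∀ w ∈ obs j, w ∈ Dir) (hlegs : ∀ m, ∀ w ∈ legs m, w ∈ Dir)
    (hloc : ∀ p, trig p = false → B p ≤ Bl ∧ reg p = ∅) (hwalk : ∀ p, trig p = true → B p ≤ θw * θ ^ (reg p).card)
    (hvert : ∀ m, cV m * Bl ^ (legs m).length ≤ θv * θ ^ (vc m).card) (K : Finset κ) :
    ∀ t ∈ expand Cov trig f c legs obs M 0 K,
      |t.coef| * (t.dirs.map fun z => ‖z‖).prod
        ≤ ((t.consts + t.groups).map (rshape trig θv θw obs oc vc reg Bl θ)).prod := by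
  intro t ht
  have hw := expand_weight_init (trig := trig) (M := M) hB0 hcV0 hB hBf hBz hcV hobs hlegs K t ht
  rw [← Multiset.prod_add, ← Multiset.map_add] at hw
  obtain ⟨hTc, hTg⟩ := expand_tidy (Cov := Cov) (trig := trig) (f := f) (c := c) (M := M) _ 0 K (Nat.lt_succ_self _)
    (envOK_zero K) t ht
  have hTidy : ∀ g ∈ t.consts + t.groups, Tidy obs legs g := fun g hg => by
    rcases Multiset.mem_add.1 hg with hg | hg
    · exact hTc g hg
    · exact hTg g hg
  have hwt0 : ∀ g : WGrp S κ ι P, 0 ≤ wt B cV g := fun g =>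
    mul_nonneg (Multiset.prod_nonneg fun x hx => by obtain ⟨p, -, rfl⟩ := Multiset.mem_map.1 hx; exact hB0 p)
      (Multiset.prod_nonneg fun x hx => by obtain ⟨m, -, rfl⟩ := Multiset.mem_map.1 hx; exact hcV0 m)
  exact hw.trans (Multiset.prod_map_le_prod_map₀ _ _ (fun g _ => hwt0 g) fun g hg =>
    wt_le_rshape hθ0 hθ1 hBl hB0 hcV0 hθv hθw hloc hwalk hvert g (hTidy g hg))

/-- **THE SIZES OF ALL THE TERMS, IN UNITS OF THEIR REFINED SHAPE, SUM TO AT MOST `W^{Φ₀(K)}`** (the refined twin of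
`BIJ88WalkLocalTermCount312.expand_l1_shape_le`): brackets of the piece `p` bounded by `B′_p·ρ_p` with `B′_p ≤ B_ℓ`,
no region, on the local pieces and `B′_p ≤ θ_w·θ^{#reg p}` on the walk pieces, couplings `cV m·B_ℓ^{|legs m|} ≤ θ_v·θ^{#vc m}`,
`0 < θ ≤ 1`, `0 < θ_v`, `0 < θ_w`, `ρ ≥ 0` with `Σ_{p : C_p u ≠ 0} ρ p ≤ ρ₀`, at most `N₀` (vertex, leg) pairs coupled
to one `C_p u`, `W ≥ 1`, `ρ₀·(Φ₀(K) + N₀) ≤ W`.  Then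
`Σ_{t ∈ expand 0 K} |coef_t|·Π_{z∈dirs_t}‖z‖ / Π_{X ∈ t.consts + t.groups} rshape X ≤ W^{Φ₀(K)}`.
[cite: BalabanImbrieJaffe1988, §5.14 p.312] -/
theorem expand_l1_rshape_le {Dir : Set (S → ℝ)} {B' ρ : P → ℝ} {cV : ι → ℝ} {Bl θ θv θw ρ₀ W : ℝ} {N₀ : ℕ}
    (hθ0 : 0 < θ) (hθ1 : θ ≤ 1) (hBl : 1 ≤ Bl) (hB0 : ∀ p, 0 ≤ B' p) (hρ : ∀ p, 0 ≤ ρ p) (hcV0 : ∀ m, 0 ≤ cV m)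
    (hθv : 0 < θv) (hθw : 0 < θw)
    (hB : ∀ p, ∀ u ∈ Dir, ∀ w ∈ Dir, |(Cov p *ᵥ u) ⬝ᵥ w| ≤ B' p * ρ p)
    (hBf : ∀ p, ∀ u ∈ Dir, |(Cov p *ᵥ u) ⬝ᵥ f| ≤ B' p * ρ p) (hBz : ∀ p, ∀ u ∈ Dir, ‖Cov p *ᵥ u‖ ≤ B' p * ρ p)
    (hcV : ∀ m, |c m| ≤ cV m) (hobs : ∀ j, ∀ w ∈ obs j, w ∈ Dir) (hlegs : ∀ m, ∀ w ∈ legs m, w ∈ Dir)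
    (hloc : ∀ p, trig p = false → B' p ≤ Bl ∧ reg p = ∅) (hwalk : ∀ p, trig p = true → B' p ≤ θw * θ ^ (reg p).card)
    (hvert : ∀ m, cV m * Bl ^ (legs m).length ≤ θv * θ ^ (vc m).card) (hρ₀0 : 0 ≤ ρ₀)
    (hρ₀ : ∀ u ∈ Dir, (∑ p ∈ univ.filter (fun p => Cov p *ᵥ u ≠ 0), ρ p) ≤ ρ₀)
    (hN : ∀ p, ∀ u ∈ Dir,
      (∑ m, ((range (legs m).length).filter fun j => (Cov p *ᵥ u) ⬝ᵥ (legs m).getD j 0 ≠ 0).card) ≤ N₀)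
    (K : Finset κ) (hW1 : 1 ≤ W)
    (hW : ρ₀ * ((∑ j ∈ K, ((obs j).length + 1 + M * maxArity legs) + N₀ : ℕ) : ℝ) ≤ W) :
    ((expand Cov trig f c legs obs M 0 K).map fun t =>
        |t.coef| * (t.dirs.map fun z => ‖z‖).prod
          / ((t.consts + t.groups).map (rshape trig θv θw obs oc vc reg Bl θ)).prod).sum
      ≤ W ^ ∑ j ∈ K, ((obs j).length + 1 + M * maxArity legs) := by
  have hBρ0 : ∀ p, 0 ≤ B' p * ρ p := fun p => mul_nonneg (hB0 p) (hρ p)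
  have hshape0 : ∀ g : WGrp S κ ι P, 0 < rshape trig θv θw obs oc vc reg Bl θ g := fun g =>
    mul_pos (mul_pos (prod_pos fun j _ => pow_pos (zero_lt_one.trans_le hBl) _) (pow_pos hθ0 _))
      (mul_pos (pow_pos hθv _) (pow_pos hθw _))
  have hpw0 : ∀ m : Multiset (WGrp S κ ι P), 0 ≤ (m.map (pw ρ)).prod := fun m =>
    Multiset.prod_nonneg fun x hx => by
      obtain ⟨g, -, rfl⟩ := Multiset.mem_map.1 hx
      exact Multiset.prod_nonneg fun y hy => by obtain ⟨p, -, rfl⟩ := Multiset.mem_map.1 hy; exact hρ p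
  have hsplit : ∀ g : WGrp S κ ι P, wt (fun p => B' p * ρ p) cV g = wt B' cV g * pw ρ g := fun g => by
    simp only [wt, pw, Multiset.prod_map_mul]; ring
  -- pointwise: the size of a term in units of its refined shape is at most its counting weight
  have hpt : ∀ t ∈ expand Cov trig f c legs obs M 0 K,
      |t.coef| * (t.dirs.map fun z => ‖z‖).prod / ((t.consts + t.groups).map (rshape trig θv θw obs oc vc reg Bl θ)).prod
        ≤ (if NondegT t then ((t.consts + t.groups).map (pw ρ)).prod else 0) := by
    intro t ht
    have hS : 0 < ((t.consts + t.groups).map (rshape trig θv θw obs oc vc reg Bl θ)).prod :=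
      Multiset.prod_pos fun x hx => by obtain ⟨g, -, rfl⟩ := Multiset.mem_map.1 hx; exact hshape0 g
    rw [div_le_iff₀ hS]
    by_cases hT : NondegT t
    · rw [if_pos hT]
      obtain ⟨hTc, hTg⟩ := expand_tidy (Cov := Cov) (trig := trig) (f := f) (c := c) (M := M) _ 0 K
        (Nat.lt_succ_self _) (envOK_zero K) t ht
      have hTidy : ∀ g ∈ t.consts + t.groups, Tidy obs legs g := fun g hg => by
        rcases Multiset.mem_add.1 hg with hg | hg
        · exact hTc g hg
        · exact hTg g hg
      have hwt0 : ∀ g : WGrp S κ ι P, 0 ≤ wt B' cV g := fun g =>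
        mul_nonneg (Multiset.prod_nonneg fun x hx => by obtain ⟨p, -, rfl⟩ := Multiset.mem_map.1 hx; exact hB0 p)
          (Multiset.prod_nonneg fun x hx => by obtain ⟨m, -, rfl⟩ := Multiset.mem_map.1 hx; exact hcV0 m)
      have hw := expand_weight_init (trig := trig) (M := M) (B := fun p => B' p * ρ p) hBρ0 hcV0 hB hBf hBz hcV
        hobs hlegs K t ht
      rw [← Multiset.prod_add, ← Multiset.map_add] at hw
      have e : ((t.consts + t.groups).map (wt (fun p => B' p * ρ p) cV)).prod
          = ((t.consts + t.groups).map (wt B' cV)).prod * ((t.consts + t.groups).map (pw ρ)).prod := by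
        rw [← Multiset.prod_map_mul]
        exact congrArg _ (Multiset.map_congr rfl fun g _ => hsplit g)
      have hle : ((t.consts + t.groups).map (wt B' cV)).prod
          ≤ ((t.consts + t.groups).map (rshape trig θv θw obs oc vc reg Bl θ)).prod :=
        Multiset.prod_map_le_prod_map₀ _ _ (fun g _ => hwt0 g) fun g hg =>
          wt_le_rshape hθ0 hθ1 hBl hB0 hcV0 hθv.le hθw.le hloc hwalk hvert g (hTidy g hg)
      calc |t.coef| * (t.dirs.map fun z => ‖z‖).prod
          ≤ ((t.consts + t.groups).map (wt B' cV)).prod * ((t.consts + t.groups).map (pw ρ)).prod := hw.trans_eq e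
        _ ≤ ((t.consts + t.groups).map (rshape trig θv θw obs oc vc reg Bl θ)).prod
              * ((t.consts + t.groups).map (pw ρ)).prod := mul_le_mul_of_nonneg_right hle (hpw0 _)
        _ = _ := mul_comm _ _
    · -- a degenerate term has size zero
      rw [if_neg hT, zero_mul]
      refine le_of_eq ?_
      simp only [NondegT, not_and_or, not_forall, not_not, exists_prop] at hT
      rcases hT with hc | ⟨z, hz, rfl⟩
      · rw [hc, abs_zero, zero_mul]
      · rw [List.prod_eq_zero (List.mem_map.2 ⟨0, hz, norm_zero⟩), mul_zero]
  exact (Multiset.sum_map_le_sum_map _ _ hpt).trans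
    (expand_lsum_init_le (trig := trig) (f := f) (c := c) hobs hlegs hρ hρ₀0 hρ₀ hN K hW1 hW)

end Expand

end Literature.MathematicalPhysics.QuantumFieldTheory.BalabanImbrieJaffe1984to88.BIJ88WalkRemainderShape312

end
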